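import Summits.QuantumFields.YangMills.Theorems.BalabanUVNodesN12AtTheta13OfThm1CCMWGenericDoorV19

/-!
# BalabanUVNodes ∕ N12 — THE TOP-LEVEL LAYER: N12's OWN STEP LETTER `kSel` PINNED TO PRINT's LAST STEP `K − 1` (+ the (1.100) pin), so that the K1⁸ closer of record's N12 family
# `∃ lamW, (∀ P, lamW.kSel P < P.K → B15Leaf (WOfRecord₁₃ F 2 θ₁₅ᶜᶜᴹᵂ(j;γ;…) lamW P)) ∧ (∀ P, 1 ≤ P.K → lamW.kSel P < P.K)` (dag-n24-c Part 34 `…N24K1R8ByNameOfOpenStubsChildrenSplitP2DMixedW` :361,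
# K1⁸ `StabilityBRunRowsAtRecordR13SepCoPH` BY NAME) is fed by FOUR raw per-run families instead of 12Zᴳ §4's six — `hsel` and the (1.100) pin equation become theorems
# (Track A, DAG node N12 = [B15, Balaban1989LargeFieldI] CMP **122** (1989) 175–202; cluster K1 — K1⁸ = stmt-QuantumFields-26907, helper; seat `pub-ymgap-dag-n12-d` g17 (R134 s2 «knit at the record»),
# 2026-08-28; count-neutral, CONDITIONAL, NOT a discharge)

HONEST FRAMING.  Count-neutral kernel COMPOSITION BY NAME plus one line of arithmetic (`K − 1 < K` for `1 ≤ K`).  WHY THIS FILE: K1⁸ BY ITS ROUTE NAME is in the tree (dag-n24-c Part 34,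
p619673, 2026-08-28T09:07Z) and reads N12 as EXACTLY the guarded pair-family that 12Zᴳ v1.1 §4 (`…GenericDoorV19.h12Fbelow_theta13OfThm1CCMW_of_massLive`) concludes, supplied there from SIX
raw families over the door letters: the (1.100) pin equation `h12pinF`, live-mass `h12massF`, Prop. 1 `h12P1F`, (1.80) `h12i180F`, (1.89) `h12c189F`, and the step guard `hselF : ∀ P, 1 ≤ P.K →
kSel P < P.K`.  Two of the six are about N12's OWN letters inside that `∃`: the residual layer's step selector `ResidW.kSel` («THE step `k` per run … located question; no default adopted»,
`Node00/CarriersW`) and its (1.100) data `D1100`.  THIS FILE ADOPTS THE DEFAULT: `kSel P := P.K − 1` — the bundle of record reads [IV]'s basic step `ρ_{K−1} ↦ 𝐑𝐓ρ_{K−1}` ((0.1)–(0.6) p.176) AT THE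
TOP OF THE RUN, its live pre-𝐑 terms and selector at the last slot `K`, which is also the WEAKEST history demand the (1.89) letters can make (`N₀(P) ≤ K`, [IV] p.177 (ii), p.181, p.200; this
seat's LOCATED-2) — together with n12-e module 14's (1.100) pin VALUE `D1100 P := rPrimeDataOfSel (reprTOfRecord₁₃ θ P (K−1)) (θ.ppSel P g K) (fibOfSeq … K)` (so the pin equation is `rfl`).
The layer is written as the structure-update literal `{λ with kSel := fun P => P.K − 1, D1100 := …}` in the statements (THEOREMS ONLY — no `def`).  §1 generic `Θ : Stage13Params F N` carrying
K0b's residuals (12E currency): the one-run row `b15Leaf_WOfRecord₁₃_liveRepin₁₃_topLevel_of_massLive_of_hasResiduals` (= 12E ★★ `…_liveRepin₁₃_of_massLive_of_hasResiduals` at the top-level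
layer with `hk := Nat.sub_lt` and `hpin := rfl`) and the guarded pair `exists_residW_b15Leaf_below_liveRepin₁₃_topLevel_…` with NO `hsel`, NO `hpin`; §2 at the generic door-cured window-edition
witness `θ₁₅ᶜᶜᴹᵂ(j;γ;ε₀,ε₂₉;B₃,B₃',a₀,a₁)` (`Θ := theta13OfNumerics … (stage12NumericsOfThm1CCMW …) …`, whose ₁₃ live re-pin it IS by `rfl`; residuals by K0a): the pair
`exists_residW_b15Leaf_below_theta13OfThm1CCMW_topLevel_of_massLive` and ★★ the family `h12FbelowTop_theta13OfThm1CCMW_of_massLive` — dag-n24-c's `h12` :361 TYPE VERBATIM — from FOUR raw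
families (live-mass at the top slot · Prop. 1 at `LF P` · (1.80) and (1.89) at `D189 P`, each guarded by `1 ≤ P.K`), reading NONE of the fifteen door letters.  WHICH CHILD BLOCKS, per run with
`1 ≤ K`: positive mass of the LIVE pre-𝐑 terms at the top slot (NODE 00; not bookkeeping — one fibre may be null), Proposition 1 (1.78) at the layer's carrier `LF P` (dag-n12-c ∕ the w-lineage;
pinned to the record's `lfVarOn su2Chart …` instances by this seat's 12Q⁸ line), (1.80) and (1.89) at the layer's letters `D189 P` (dag-n12-e's pins discharge (1.89) on NODE O's (2.7)-small window
road, 12Pᵂ ∕ 12Zᴳ-b; RAW here because the family ranges over every door `γ ≤ ½` and every run).  `LF` ∕ `D189` stay the supplier's letters in this edition (their object pins are the 12Q⁸ ∕ 12W-H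
lines); nothing of Bałaban's is asserted; every printed fact is a hypothesis; N12 is NOT discharged; no node is discharged; K0⁷ ∕ K1⁸ NOT closed; counts unmoved (discharged 5∕27 · Track A 5∕28).
ONE finite four-torus programme at fixed `ε = L^{-K}` — nothing continuum ∕ ℝ⁴ ∕ OS ∕ mass gap ∕ Clay.  No `sorry`, `def`, `instance`, `notation`.

Sources: [Balaban1989LargeFieldI] (0.1)–(0.6) pp.175–176, p.176 ll.14–16, p.177 (i)–(ii), p.181, Prop. 1 (1.78) p.194, (1.80) p.195, (1.89) p.198, (1.99)–(1.102) pp.200–201;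
[Balaban1988Convergent] (2.18) p.257, (3.16) p.268, (3.22)–(3.25) pp.269–270; [Balaban1985Variational] Thm 1 (8)–(9) p.279; [Balaban1987RG1] Thm 1 p.259, §1 p.264 (the unread door letters).
-/

noncomputable section

open MeasureTheory
open scoped Matrix.Norms.L2Operator

namespace Summit.QuantumFields.YangMills.BalabanUVNodes.N12AtTheta13OfThm1CCMWGenericDoorTopLevel

open Literature.MathematicalPhysics.QuantumFieldTheory.Balaban1983to89
open Literature.MathematicalPhysics.QuantumFieldTheory.Balaban1983to89.T4Continuum (T4Family)
open Literature.MathematicalPhysics.QuantumFieldTheory.Balaban1983to89.DagBinding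
open Literature.MathematicalPhysics.QuantumFieldTheory.Balaban1983to89.Node00
open FlowStep (BetaLowerH BetaUpperH)
open B15Claim189Assembly (new189 chiPP dom)
open B15 (Prop1Printed Ineq180)
open B15.BasicStep (Claim189)
open B8Eq17ClassAkV1 (plaqsOf)
open B15RPrime1100OfRep (rPrimeDataOfSel)
open Summit.QuantumFields.YangMills.BalabanUVNodes.N12AtRecord13OfResiduals (b15Leaf_WOfRecord₁₃_liveRepin₁₃_of_massLive_of_hasResiduals)

variable {F : T4Family}

/-! ## §1 GENERIC `Θ` WITH K0b's RESIDUALS (12E currency): N12's row and the guarded pair at the TOP-LEVEL (1.100)-pinned layer of the ₁₃ live re-pin -/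

section Generic
variable {N : ℕ} [NeZero N] (Θ : Stage13Params F N) (lam : ResidW F N)

/-- **★★ N12's ROW AT THE TOP-LEVEL LAYER OF THE ₁₃ LIVE RE-PIN, FROM K0b's RESIDUALS ALONE** (run with `1 ≤ K`): the layer `{λ with kSel := K − 1, D1100 := the 𝐑-step's own (1.100) reading at
`K − 1`}` — print's LAST basic step — so 12E's `hk` is `K − 1 < K` and its pin equation `hpin` is `rfl`; what stays displayed is «every LIVE pre-𝐑 term at the top slot `K` has positive mass» +
EXACTLY Proposition 1 (1.78) at `λ.LF P`, (1.80) and (1.89) at `λ.D189 P`.  NO `Provisos₁₃`, NO admissibility, NO `hfib`, NO `hsel`, NO `hpin`.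
[cite: Balaban1989LargeFieldI, (0.1)–(0.6) pp.175–176, p.176 ll.14–16, p.177 (i)–(ii), Prop. 1 (1.78) p.194, (1.80) p.195, (1.89) p.198, (1.99)–(1.102) pp.200–201; Balaban1988Convergent, (3.16) p.268, (3.22)–(3.25) pp.269–270] -/
theorem b15Leaf_WOfRecord₁₃_liveRepin₁₃_topLevel_of_massLive_of_hasResiduals (hres : Θ.HasResidualsOfRecord F N) {P : B12.RunParams} (hK : 1 ≤ P.K)
    (hmassLive : ∀ s, LiveSeq F N Θ.ν Θ.τ9 P (gOfRecord₁₃ F N (Θ.liveRepin₁₃ F N) P) (P.K - 1 + 1)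
        (slotsTOfRecord F N Θ.ν Θ.τ9 (EOfRecord₁₃ F N (Θ.liveRepin₁₃ F N)) (wOfRecord₉ F N (Θ.liveRepin₁₃ F N).toStage9Params)
          (Θ.liveRepin₁₃ F N).ppSel P (gOfRecord₁₃ F N (Θ.liveRepin₁₃ F N) P) (P.K - 1 + 1)) s →
      0 < ∫ V, rterm (reprTOfRecord₁₃ F N (Θ.liveRepin₁₃ F N) P (P.K - 1)) s V ∂(fieldMeasure (F.P P.K) (P.K - 1 + 1) (SU N)))
    (hP1 : Prop1Printed (lam.LF P))
    (h180 : ∀ U, new189 (lam.D189 P) U → ∀ i, (lam.D189 P).h ≤ i → i ≤ (lam.D189 P).k → ∀ q ∈ plaqsOf (dom (lam.D189 P) i),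
      Ineq180 ((lam.D189 P).dev0 U q) ((lam.D189 P).ε (lam.D189 P).k) (lam.D189 P).η (lam.D189 P).B₃ (lam.D189 P).B₅ (lam.D189 P).M (lam.D189 P).δ
        ((lam.D189 P).dist q) (lam.D189 P).O1)
    (h189 : Claim189 (new189 (lam.D189 P)) (chiPP (lam.D189 P))) :
    B15Leaf (WOfRecord₁₃ F N (Θ.liveRepin₁₃ F N)
      { lam with kSel := fun P : B12.RunParams => P.K - 1, D1100 := fun P : B12.RunParams => rPrimeDataOfSel (reprTOfRecord₁₃ F N (Θ.liveRepin₁₃ F N) P (P.K - 1)) ((Θ.liveRepin₁₃ F N).ppSel P (gOfRecord₁₃ F N (Θ.liveRepin₁₃ F N) P) (P.K - 1 + 1)) (fibOfSeq F (Θ.liveRepin₁₃ F N).ν (Θ.liveRepin₁₃ F N).τ9 P (gOfRecord₁₃ F N (Θ.liveRepin₁₃ F N) P) (P.K - 1 + 1)) } P) :=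
  b15Leaf_WOfRecord₁₃_liveRepin₁₃_of_massLive_of_hasResiduals Θ
    { lam with kSel := fun P : B12.RunParams => P.K - 1, D1100 := fun P : B12.RunParams => rPrimeDataOfSel (reprTOfRecord₁₃ F N (Θ.liveRepin₁₃ F N) P (P.K - 1)) ((Θ.liveRepin₁₃ F N).ppSel P (gOfRecord₁₃ F N (Θ.liveRepin₁₃ F N) P) (P.K - 1 + 1)) (fibOfSeq F (Θ.liveRepin₁₃ F N).ν (Θ.liveRepin₁₃ F N).τ9 P (gOfRecord₁₃ F N (Θ.liveRepin₁₃ F N) P) (P.K - 1 + 1)) }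
    hres (Nat.sub_lt hK Nat.one_pos) rfl hmassLive hP1 h180 h189

/-- **★★ THE GUARDED PAIR AT THE ₁₃ LIVE RE-PIN OF A GENERIC `Θ` WITH K0b's RESIDUALS, FROM FOUR RAW PER-RUN ROWS** — `∃ lamW, (∀ P, lamW.kSel P < P.K → B15Leaf (WOfRecord₁₃ (Θ.liveRepin₁₃) lamW P))
∧ (∀ P, 1 ≤ P.K → lamW.kSel P < P.K)`, witnessed by the top-level layer: the step guard is `Nat.sub_lt`, the (1.100) pin is `rfl`; displayed per run with `1 ≤ K`: live-mass at the top slot,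
Prop. 1 at `λ.LF P`, (1.80) and (1.89) at `λ.D189 P`. [cite: Balaban1989LargeFieldI, (0.1)–(0.6) pp.175–176, Prop. 1 (1.78) p.194, (1.80) p.195, (1.89) p.198, (1.99)–(1.102) pp.200–201; Balaban1988Convergent, (2.18) p.257, (3.25) p.270 (bookkeeping)] -/
theorem exists_residW_b15Leaf_below_liveRepin₁₃_topLevel_of_massLive_of_hasResiduals (hres : Θ.HasResidualsOfRecord F N)
    (hmassTop : ∀ P : B12.RunParams, 1 ≤ P.K → ∀ s, LiveSeq F N Θ.ν Θ.τ9 P (gOfRecord₁₃ F N (Θ.liveRepin₁₃ F N) P) (P.K - 1 + 1)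
        (slotsTOfRecord F N Θ.ν Θ.τ9 (EOfRecord₁₃ F N (Θ.liveRepin₁₃ F N)) (wOfRecord₉ F N (Θ.liveRepin₁₃ F N).toStage9Params)
          (Θ.liveRepin₁₃ F N).ppSel P (gOfRecord₁₃ F N (Θ.liveRepin₁₃ F N) P) (P.K - 1 + 1)) s →
      0 < ∫ V, rterm (reprTOfRecord₁₃ F N (Θ.liveRepin₁₃ F N) P (P.K - 1)) s V ∂(fieldMeasure (F.P P.K) (P.K - 1 + 1) (SU N)))
    (hP1 : ∀ P : B12.RunParams, 1 ≤ P.K → Prop1Printed (lam.LF P))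
    (h180 : ∀ P : B12.RunParams, 1 ≤ P.K → ∀ U, new189 (lam.D189 P) U → ∀ i, (lam.D189 P).h ≤ i → i ≤ (lam.D189 P).k → ∀ q ∈ plaqsOf (dom (lam.D189 P) i),
      Ineq180 ((lam.D189 P).dev0 U q) ((lam.D189 P).ε (lam.D189 P).k) (lam.D189 P).η (lam.D189 P).B₃ (lam.D189 P).B₅ (lam.D189 P).M (lam.D189 P).δ
        ((lam.D189 P).dist q) (lam.D189 P).O1)
    (h189 : ∀ P : B12.RunParams, 1 ≤ P.K → Claim189 (new189 (lam.D189 P)) (chiPP (lam.D189 P))) :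
    ∃ lamW : ResidW F N, (∀ P : B12.RunParams, lamW.kSel P < P.K → B15Leaf (WOfRecord₁₃ F N (Θ.liveRepin₁₃ F N) lamW P)) ∧
      ∀ P : B12.RunParams, 1 ≤ P.K → lamW.kSel P < P.K := by
  refine ⟨{ lam with kSel := fun P : B12.RunParams => P.K - 1, D1100 := fun P : B12.RunParams => rPrimeDataOfSel (reprTOfRecord₁₃ F N (Θ.liveRepin₁₃ F N) P (P.K - 1)) ((Θ.liveRepin₁₃ F N).ppSel P (gOfRecord₁₃ F N (Θ.liveRepin₁₃ F N) P) (P.K - 1 + 1)) (fibOfSeq F (Θ.liveRepin₁₃ F N).ν (Θ.liveRepin₁₃ F N).τ9 P (gOfRecord₁₃ F N (Θ.liveRepin₁₃ F N) P) (P.K - 1 + 1)) }, fun P hk => ?_, fun P hK => Nat.sub_lt hK Nat.one_pos⟩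
  have hK : 1 ≤ P.K := Nat.one_le_of_lt hk
  exact b15Leaf_WOfRecord₁₃_liveRepin₁₃_topLevel_of_massLive_of_hasResiduals Θ lam hres hK (hmassTop P hK) (hP1 P hK) (h180 P hK) (h189 P hK)

end Generic

/-! ## §2 AT THE GENERIC DOOR-CURED WINDOW-EDITION WITNESS `θ₁₅ᶜᶜᴹᵂ(j;γ;ε₀,ε₂₉;B₃,B₃',a₀,a₁)`: the guarded pair and dag-n24-c's `h12` family FROM FOUR RAW FAMILIES -/

section TopLevelRow
variable {j : ℕ} {γ ε₀ ε₂₉ B₃ B₃' a₀ a₁ : ℝ} (lamW : ResidW F 2)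

/-- **★★ THE GUARDED PAIR AT ONE GENERIC WITNESS `θ₁₅ᶜᶜᴹᵂ(j;γ;ε₀,ε₂₉;B₃,B₃',a₀,a₁)` FROM FOUR RAW ROWS** — `(∀ P, lamW.kSel P < P.K → B15Leaf (WOfRecord₁₃ F 2 θW lamW P)) ∧
(∀ P, 1 ≤ P.K → lamW.kSel P < P.K)` witnessed by the TOP-LEVEL (1.100)-pinned layer over the supplier's letters `λ.LF ∕ λ.D189` (12Zᴳ §4's pair with `h12pin` ∕ `hsel` DISCHARGED: `rfl` ∕
`Nat.sub_lt`): displayed per run with `1 ≤ K` — positive mass of the LIVE pre-𝐑 terms at the top slot `K` (NODE 00), Prop. 1 (1.78) at `λ.LF P`, (1.80) and (1.89) at `λ.D189 P`; §1 at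
`Θ := theta13OfNumerics … (stage12NumericsOfThm1CCMW F.L j γ …) …` (K0b's residuals by K0a).  NO door letter read.  CONDITIONAL on the displayed rows; nothing of Bałaban asserted; N12 NOT discharged.
[cite: Balaban1989LargeFieldI, (0.1)–(0.6) pp.175–176, p.176 ll.14–16, Prop. 1 (1.78) p.194, (1.80) p.195, (1.89) p.198, (1.99)–(1.102) pp.200–201; Balaban1988Convergent, (2.18) p.257, (3.16) p.268, (3.22)–(3.25) pp.269–270 (bookkeeping)] -/
theorem exists_residW_b15Leaf_below_theta13OfThm1CCMW_topLevel_of_massLive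
    (h12massTop : ∀ P : B12.RunParams, 1 ≤ P.K → ∀ s, LiveSeq F 2 (theta13OfThm1CCMW F 2 j γ ε₀ ε₂₉ B₃ B₃' a₀ a₁).ν (theta13OfThm1CCMW F 2 j γ ε₀ ε₂₉ B₃ B₃' a₀ a₁).τ9 P (gOfRecord₁₃ F 2 (theta13OfThm1CCMW F 2 j γ ε₀ ε₂₉ B₃ B₃' a₀ a₁) P) (P.K - 1 + 1)
        (slotsTOfRecord F 2 (theta13OfThm1CCMW F 2 j γ ε₀ ε₂₉ B₃ B₃' a₀ a₁).ν (theta13OfThm1CCMW F 2 j γ ε₀ ε₂₉ B₃ B₃' a₀ a₁).τ9 (EOfRecord₁₃ F 2 (theta13OfThm1CCMW F 2 j γ ε₀ ε₂₉ B₃ B₃' a₀ a₁)) (wOfRecord₉ F 2 (theta13OfThm1CCMW F 2 j γ ε₀ ε₂₉ B₃ B₃' a₀ a₁).toStage9Params)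
          (theta13OfThm1CCMW F 2 j γ ε₀ ε₂₉ B₃ B₃' a₀ a₁).ppSel P (gOfRecord₁₃ F 2 (theta13OfThm1CCMW F 2 j γ ε₀ ε₂₉ B₃ B₃' a₀ a₁) P) (P.K - 1 + 1)) s →
      0 < ∫ V, rterm (reprTOfRecord₁₃ F 2 (theta13OfThm1CCMW F 2 j γ ε₀ ε₂₉ B₃ B₃' a₀ a₁) P (P.K - 1)) s V ∂(fieldMeasure (F.P P.K) (P.K - 1 + 1) (SU 2)))
    (h12P1 : ∀ P : B12.RunParams, 1 ≤ P.K → Prop1Printed (lamW.LF P))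
    (h12i180 : ∀ P : B12.RunParams, 1 ≤ P.K → ∀ U, new189 (lamW.D189 P) U → ∀ i, (lamW.D189 P).h ≤ i → i ≤ (lamW.D189 P).k →
      ∀ q ∈ plaqsOf (dom (lamW.D189 P) i),
        Ineq180 ((lamW.D189 P).dev0 U q) ((lamW.D189 P).ε (lamW.D189 P).k) (lamW.D189 P).η (lamW.D189 P).B₃ (lamW.D189 P).B₅ (lamW.D189 P).M (lamW.D189 P).δ
          ((lamW.D189 P).dist q) (lamW.D189 P).O1)
    (h12c189 : ∀ P : B12.RunParams, 1 ≤ P.K → Claim189 (new189 (lamW.D189 P)) (chiPP (lamW.D189 P))) :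
    ∃ lamW : ResidW F 2, (∀ P : B12.RunParams, lamW.kSel P < P.K → B15Leaf (WOfRecord₁₃ F 2 (theta13OfThm1CCMW F 2 j γ ε₀ ε₂₉ B₃ B₃' a₀ a₁) lamW P)) ∧
      ∀ P : B12.RunParams, 1 ≤ P.K → lamW.kSel P < P.K :=
  exists_residW_b15Leaf_below_liveRepin₁₃_topLevel_of_massLive_of_hasResiduals (theta13OfNumerics F 2 (stage12NumericsOfThm1CCMW F.L j γ ε₀ B₃ B₃' a₀ a₁) ε₂₉ (zeta316OfRecord F 2 (stage12NumericsOfThm1CCMW F.L j γ ε₀ B₃ B₃' a₀ a₁).ν (stage12NumericsOfThm1CCMW F.L j γ ε₀ B₃ B₃' a₀ a₁).τ9.M (stage12NumericsOfThm1CCMW F.L j γ ε₀ B₃ B₃' a₀ a₁).A₁) (RzOfRecord F 2) (ZtOfRecord F 2)) lamW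
    (hasResidualsOfRecord_theta13OfNumerics F 2 (stage12NumericsOfThm1CCMW F.L j γ ε₀ B₃ B₃' a₀ a₁) ε₂₉) h12massTop h12P1 h12i180 h12c189

end TopLevelRow

section TopLevelFamily
variable (lamW : ∀ (j : ℕ) (γ ε₀ ε₂₉ B₃ B₃' a₀ a₁ : ℝ), ResidW F 2)

/-- **★★ dag-n24-c's `h12` FAMILY OF THE K1⁸-BY-NAME CLOSER — ITS TYPE VERBATIM (Part 34 :361) — FROM FOUR RAW FAMILIES OVER THE WITNESS LETTERS ONLY**: live-mass at the top slot, Prop. 1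
at `LF P`, (1.80) and (1.89) at `D189 P`, each below `1 ≤ P.K`; the step guard and the (1.100) pin of 12Zᴳ §4 are theorems at the top-level layer.  So «what N12 owes K1⁸'s closer of record»
is, per door witness and per run with `1 ≤ K`, EXACTLY these four rows (the layer's `LF` ∕ `D189` being the supplier's letters — object pins: 12Q⁸ ∕ 12W-H lines).  None of the fifteen door
letters is read.  CONDITIONAL; nothing of Bałaban asserted; N12 NOT discharged; K0⁷ ∕ K1⁸ NOT closed. [cite: Balaban1989LargeFieldI, (0.1)–(0.6) pp.175–176, Prop. 1 (1.78) p.194, (1.80) p.195, (1.89) p.198, (1.99)–(1.102) pp.200–201; Balaban1988Convergent, (2.18) p.257, (3.16) p.268, (3.22)–(3.25) pp.269–270; Balaban1985Variational, Thm 1 (8)–(9) p.279; Balaban1987RG1, Thm 1 p.259, §1 p.264 (bookkeeping: the unread door letters)] -/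
theorem h12FbelowTop_theta13OfThm1CCMW_of_massLive
    (h12massTopF : ∀ (j : ℕ) (γ ε₀ ε₂₉ B₃ B₃' a₀ a₁ : ℝ), ∀ P : B12.RunParams, 1 ≤ P.K → ∀ s, LiveSeq F 2 (theta13OfThm1CCMW F 2 j γ ε₀ ε₂₉ B₃ B₃' a₀ a₁).ν (theta13OfThm1CCMW F 2 j γ ε₀ ε₂₉ B₃ B₃' a₀ a₁).τ9 P (gOfRecord₁₃ F 2 (theta13OfThm1CCMW F 2 j γ ε₀ ε₂₉ B₃ B₃' a₀ a₁) P) (P.K - 1 + 1)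
        (slotsTOfRecord F 2 (theta13OfThm1CCMW F 2 j γ ε₀ ε₂₉ B₃ B₃' a₀ a₁).ν (theta13OfThm1CCMW F 2 j γ ε₀ ε₂₉ B₃ B₃' a₀ a₁).τ9 (EOfRecord₁₃ F 2 (theta13OfThm1CCMW F 2 j γ ε₀ ε₂₉ B₃ B₃' a₀ a₁)) (wOfRecord₉ F 2 (theta13OfThm1CCMW F 2 j γ ε₀ ε₂₉ B₃ B₃' a₀ a₁).toStage9Params)
          (theta13OfThm1CCMW F 2 j γ ε₀ ε₂₉ B₃ B₃' a₀ a₁).ppSel P (gOfRecord₁₃ F 2 (theta13OfThm1CCMW F 2 j γ ε₀ ε₂₉ B₃ B₃' a₀ a₁) P) (P.K - 1 + 1)) s →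
      0 < ∫ V, rterm (reprTOfRecord₁₃ F 2 (theta13OfThm1CCMW F 2 j γ ε₀ ε₂₉ B₃ B₃' a₀ a₁) P (P.K - 1)) s V ∂(fieldMeasure (F.P P.K) (P.K - 1 + 1) (SU 2)))
    (h12P1F : ∀ (j : ℕ) (γ ε₀ ε₂₉ B₃ B₃' a₀ a₁ : ℝ), ∀ P : B12.RunParams, 1 ≤ P.K → Prop1Printed ((lamW j γ ε₀ ε₂₉ B₃ B₃' a₀ a₁).LF P))
    (h12i180F : ∀ (j : ℕ) (γ ε₀ ε₂₉ B₃ B₃' a₀ a₁ : ℝ), ∀ P : B12.RunParams, 1 ≤ P.K → ∀ U, new189 ((lamW j γ ε₀ ε₂₉ B₃ B₃' a₀ a₁).D189 P) U → ∀ i, ((lamW j γ ε₀ ε₂₉ B₃ B₃' a₀ a₁).D189 P).h ≤ i → i ≤ ((lamW j γ ε₀ ε₂₉ B₃ B₃' a₀ a₁).D189 P).k →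
      ∀ q ∈ plaqsOf (dom ((lamW j γ ε₀ ε₂₉ B₃ B₃' a₀ a₁).D189 P) i),
        Ineq180 (((lamW j γ ε₀ ε₂₉ B₃ B₃' a₀ a₁).D189 P).dev0 U q) (((lamW j γ ε₀ ε₂₉ B₃ B₃' a₀ a₁).D189 P).ε ((lamW j γ ε₀ ε₂₉ B₃ B₃' a₀ a₁).D189 P).k) ((lamW j γ ε₀ ε₂₉ B₃ B₃' a₀ a₁).D189 P).η ((lamW j γ ε₀ ε₂₉ B₃ B₃' a₀ a₁).D189 P).B₃ ((lamW j γ ε₀ ε₂₉ B₃ B₃' a₀ a₁).D189 P).B₅ ((lamW j γ ε₀ ε₂₉ B₃ B₃' a₀ a₁).D189 P).M ((lamW j γ ε₀ ε₂₉ B₃ B₃' a₀ a₁).D189 P).δ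
          (((lamW j γ ε₀ ε₂₉ B₃ B₃' a₀ a₁).D189 P).dist q) ((lamW j γ ε₀ ε₂₉ B₃ B₃' a₀ a₁).D189 P).O1)
    (h12c189F : ∀ (j : ℕ) (γ ε₀ ε₂₉ B₃ B₃' a₀ a₁ : ℝ), ∀ P : B12.RunParams, 1 ≤ P.K → Claim189 (new189 ((lamW j γ ε₀ ε₂₉ B₃ B₃' a₀ a₁).D189 P)) (chiPP ((lamW j γ ε₀ ε₂₉ B₃ B₃' a₀ a₁).D189 P))) :
    ∀ {j c : ℕ} {γ ε₀ ε₂₉ B₃ B₃' a₀ a₁ : ℝ} (hγ₀ : 0 < γ) (hγh : γ ≤ 1 / 2) (hε : 0 < ε₀) (hε' : 0 < ε₂₉) (hB : 0 ≤ B₃) (hB' : 0 ≤ B₃') (ha₀ : 0 < a₀) (ha₁ : 0 < a₁) (h15 : VariationalThm1RegSepCoP7M F 2 B₃ a₀ a₁) (hc : c ≤ F.L ^ j) (h9 : Gauge9RegSepTopStepR F 2 (fun ν K Ω => suppDomOfRecord F ν K Ω) (F.L ^ j) c B₃ B₃' a₀ a₁) {bl β' : ℝ} (hbox : BetaLowerH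 bl γ (betaOfRecord₁₃ F 2 (theta13OfThm1CCMW F 2 j γ ε₀ ε₂₉ B₃ B₃' a₀ a₁))) (hbox' : BetaUpperH β' γ (betaOfRecord₁₃ F 2 (theta13OfThm1CCMW F 2 j γ ε₀ ε₂₉ B₃ B₃' a₀ a₁))) (hl : -bl * γ ^ 2 ≤ 3) (hβ' : β' * γ ^ 2 ≤ 3 / 4),
      ∃ lamW : ResidW F 2, (∀ P : B12.RunParams, lamW.kSel P < P.K → B15Leaf (WOfRecord₁₃ F 2 (theta13OfThm1CCMW F 2 j γ ε₀ ε₂₉ B₃ B₃' a₀ a₁) lamW P)) ∧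
      ∀ P : B12.RunParams, 1 ≤ P.K → lamW.kSel P < P.K := by
  intro j _ γ ε₀ ε₂₉ B₃ B₃' a₀ a₁ _ _ _ _ _ _ _ _ _ _ _ _ _ _ _ _ _
  exact exists_residW_b15Leaf_below_theta13OfThm1CCMW_topLevel_of_massLive (lamW j γ ε₀ ε₂₉ B₃ B₃' a₀ a₁)
    (h12massTopF j γ ε₀ ε₂₉ B₃ B₃' a₀ a₁) (h12P1F j γ ε₀ ε₂₉ B₃ B₃' a₀ a₁) (h12i180F j γ ε₀ ε₂₉ B₃ B₃' a₀ a₁) (h12c189F j γ ε₀ ε₂₉ B₃ B₃' a₀ a₁)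

end TopLevelFamily

end Summit.QuantumFields.YangMills.BalabanUVNodes.N12AtTheta13OfThm1CCMWGenericDoorTopLevel

end
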